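import Summits.BirchSwinnertonDyer.BirchSwinnertonDyer.Theses.KatoDescentPotSupersingular
import Summits.BirchSwinnertonDyer.BirchSwinnertonDyer.Theses.KatoDescentTamePotSupersingular
import Summits.BirchSwinnertonDyer.BirchSwinnertonDyer.Theorems.PoitouTateSelmerStructureDualityConjHolds
import HarnessLib

set_option linter.dupNamespace false -- `…BirchSwinnertonDyer.BirchSwinnertonDyer…` is the cell's nested layout (D-0017)
set_option autoImplicit false

/-!
# Item 27963 `HeldPoitouTateSelmerDualityQ` (routes `KatoDescentPotSupersingular`, `KatoDescentTamePotSupersingular`, support 303) —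
# Poitou–Tate duality for Selmer structures over `ℚ` (the four-conjunct named fact at `K = ℚ`) — PROVED BY NAME

`--workitem` stmt-BirchSwinnertonDyer-27963 (one item by dedup, wanted by both Kato-descent routes; a gen-4/gen-5 child of crux M
`ReducibleKatoMember`, stmt-19196). THEOREMS ONLY (no definition, no named fact, no `sorry`).

The item is the BY-NAME ALIAS `(Literature.NumberTheory.GaloisCohomology.poitouTate_selmerStructure_duality ℚ : Prop)` of the tree's
named published fact (Milne *ADT* I Thm. 4.10 (b), Mazur–Rubin Thm. 2.3.4). That fact is now a THEOREM OF THE TREE at every number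
field: `InputsPoitouTateSelmer.poitouTate_selmerStructure_duality_conj_holds K` (route-free module
`Theorems.PoitouTateSelmerStructureDualityConjHolds`, composed from the `bsd-schneider` / `bsd-jet` kernel theorems) followed by the
Literature bridge `poitouTate_selmerStructure_duality_of_conj` (forget the conjugation-compatibility conjunct); equivalently
`SchneiderFreeAdditiveX3.PoitouTateReduction.poitouTate_selmerStructure_duality_holds ℚ`. This leaf file records it against the two
route declarations by `unfold; exact …`.

Honest framing: UNCONDITIONAL (classical Poitou–Tate duality, kernel-checked elsewhere in the tree). Closing item 27963 discharges the
HELD Poitou–Tate child of crux M on the two Kato-descent routes AS TYPED only: M stays settled MODULO its remaining HELD published-input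
children (`PublishedInputMemberHullZetaCore`, `PublishedInputsModularityGZK` / `PublishedInputNewformKatoZ`, `PublishedInputRankEqAnalyticRankOfLOneNeZero`);
no crux of substance and no summit statement is proved; the Birch–Swinnerton-Dyer conjecture is NOT proved by any of this.
References: [MilneADT2006] Ch. I, Thm. 4.10 (b); [Howard2004HeegnerKolyvagin] Thm. 2.1.11; [MazurRubin2004] Thm. 2.3.4.
-/

namespace Summit.BirchSwinnertonDyer.BirchSwinnertonDyer.Theorems.InputsPoitouTateSelmer

open Literature.NumberTheory.GaloisCohomology

/-- **Item 27963 on route `KatoDescentPotSupersingular` — `HeldPoitouTateSelmerDualityQ` PROVED (by name):**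
`poitouTate_selmerStructure_duality ℚ` from `poitouTate_selmerStructure_duality_conj_holds ℚ` through
`poitouTate_selmerStructure_duality_of_conj`. Unconditional; closes item 27963; BSD is not proved by this.
[cite: MilneADT2006, Ch. I, Thm. 4.10 (b) (proof, p. 58), Cor. 2.3, Thm. 2.6]
[cite: Howard2004HeegnerKolyvagin, Thm. 2.1.11 (arXiv:1202.6340 p. 6)] -/
theorem katoDescentPotSupersingular_heldPoitouTateSelmerDualityQ_proof :
    Summit.BirchSwinnertonDyer.BirchSwinnertonDyer.Theses.KatoDescentPotSupersingular.HeldPoitouTateSelmerDualityQ := by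
  unfold Summit.BirchSwinnertonDyer.BirchSwinnertonDyer.Theses.KatoDescentPotSupersingular.HeldPoitouTateSelmerDualityQ
  exact poitouTate_selmerStructure_duality_of_conj (poitouTate_selmerStructure_duality_conj_holds ℚ)

/-- **Item 27963 on route `KatoDescentTamePotSupersingular` — the same item (one item by dedup), `HeldPoitouTateSelmerDualityQ`
PROVED (by name).** Unconditional; BSD is not proved by this. [cite: MilneADT2006, Ch. I, Thm. 4.10 (b) (proof, p. 58)]
[cite: Howard2004HeegnerKolyvagin, Thm. 2.1.11 (arXiv:1202.6340 p. 6)] -/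
theorem katoDescentTamePotSupersingular_heldPoitouTateSelmerDualityQ_proof :
    Summit.BirchSwinnertonDyer.BirchSwinnertonDyer.Theses.KatoDescentTamePotSupersingular.HeldPoitouTateSelmerDualityQ := by
  unfold Summit.BirchSwinnertonDyer.BirchSwinnertonDyer.Theses.KatoDescentTamePotSupersingular.HeldPoitouTateSelmerDualityQ
  exact poitouTate_selmerStructure_duality_of_conj (poitouTate_selmerStructure_duality_conj_holds ℚ)

end Summit.BirchSwinnertonDyer.BirchSwinnertonDyer.Theorems.InputsPoitouTateSelmer
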